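import Summits.CriticalPhenomena.CardyFormulaZ2.Theses.CardyRotToConf
import Summits.CriticalPhenomena.CardyFormulaZ2.Theorems.CardyRotToConfR2SymmetryUpgrade.Negative.LoadBearing
import Summits.CriticalPhenomena.CardyFormulaZ2.Theorems.CardyRotToConfR2SymmetryUpgrade.Negative.MarkovRenewal
import Literature.Probability.RandomPlanarGeometry.ChordalCurveFamilyProofs

/-!
# `CardyRotToConfR2SymmetryUpgrade` (stmt-CriticalPhenomena-0698): mixtures — the four linear
# axioms and the non-tracing clause are convex, the typed domain Markov property is not

By-product of the cdisprove unit (standing adversary, cycle 3). The hypothesis bundle of the crux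
is `IsChordal ∧ IsSimilarityCovariant ∧ IsDomainMarkov ∧ IsLocal ∧ IsTargetIndependent` plus the
non-tracing clause. Five of these six constraints are LINEAR (or convex) in the family `P`:

* `isLocal_mix`, `isTargetIndependent_mix` — both locality forms are equalities between values of
  measures on sets, hence closed under arbitrary non-negative combinations `s • P₁ + t • P₂`;
* `isSimilarityCovariant_mix` — push-forward is linear (`Measure.map_add`, `Measure.map_smul`);
* `isChordal_mix` (`s + t = 1`), `nonTracing_mix` — almost-sure clauses pass to mixtures.

So every refutation or construction may AVERAGE (e.g. over the rotation group, to manufacture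
similarity covariance from translation and dilation covariance alone) at the sole cost of
re-verifying the domain Markov property — which is genuinely non-convex:

* `isDomainMarkov_constTarget`, `isLocal_constTarget`, `isSimilarityCovariant_constTarget` — the
  degenerate family "sit at the target `b`" is typed-Markov (kernel: always `δ_{const b}`), local and
  similarity covariant (it is not chordal: its curves start at `b`);
* `not_isDomainMarkov_mix_tip_constTarget` — the half-half mixture of the tree's `tipFamily` ("sit
  at `a`", typed-Markov by `isDomainMarkov_tipFamily`) with it is NOT typed-Markov. Mechanism: the
  `initial` clause forces the kernel at the trivial past to be the FRESH mixture, while the true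
  conditional future remembers which component was drawn ("label memory"). This is the finite
  shadow of the renewal obstruction (`MarkovRenewal.kernel_eq_of_jordan_remaining`, REVIEW.md of the
  crux item) that kills the rotation-averaged stretched-SLE₆ candidate and every hidden-label
  mixture: `markov_eq_lintegral_fresh` / `no_memory_at_jordan_renewal` below state that obstruction
  for a general Markov family — at configurations whose remaining domain is a Jordan carrier the
  future is drawn from the family's own fresh law, so an event of pasts and an event of futures that
  never occur together under `P D` cannot both be charged (past event by `P D`, future event by every
  fresh law).
-/

noncomputable section

open Set MeasureTheory Topology Filter
open scoped unitInterval ENNReal NNReal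

namespace Summit.CriticalPhenomena.CardyFormulaZ2.Theorems.CardyRotToConfR2SymmetryUpgrade.Negative

open Literature.Probability.RandomPlanarGeometry
open Literature.Probability.RandomPlanarGeometry.ChordalFamily

/-! ### The linear axioms are convex -/

section Linear

variable {P₁ P₂ : ChordalFamily} (s t : ℝ≥0∞)

/-- Restriction locality is closed under non-negative combinations. [folklore] -/
theorem isLocal_mix (h₁ : P₁.IsLocal) (h₂ : P₂.IsLocal) :
    IsLocal (fun D => s • P₁ D + t • P₂ D) := by
  intro D D' hsub h0 h1 T hT
  simp only [Measure.add_apply, Measure.smul_apply, h₁ D D' hsub h0 h1 T hT, h₂ D D' hsub h0 h1 T hT]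

/-- Splitting locality (target independence) is closed under non-negative combinations.
[folklore] -/
theorem isTargetIndependent_mix (h₁ : P₁.IsTargetIndependent) (h₂ : P₂.IsTargetIndependent) :
    IsTargetIndependent (fun D => s • P₁ D + t • P₂ D) := by
  intro D T hT
  simp only [Measure.add_apply, Measure.smul_apply, h₁ D T hT, h₂ D T hT]

/-- Similarity covariance is closed under non-negative combinations. [folklore] -/
theorem isSimilarityCovariant_mix (h₁ : P₁.IsSimilarityCovariant) (h₂ : P₂.IsSimilarityCovariant) :
    IsSimilarityCovariant (fun D => s • P₁ D + t • P₂ D) := by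
  intro D c hc w
  simp only
  rw [Measure.map_add _ _ (measurable_curveClassMap_similarity c hc w), Measure.map_smul,
    Measure.map_smul, h₁ D c hc w, h₂ D c hc w]

/-- Chordality is closed under convex combinations. [folklore] -/
theorem isChordal_mix (h₁ : P₁.IsChordal) (h₂ : P₂.IsChordal) (hst : s + t = 1) :
    IsChordal (fun D => s • P₁ D + t • P₂ D) := by
  intro D
  obtain ⟨hp₁, hae₁⟩ := h₁ D
  obtain ⟨hp₂, hae₂⟩ := h₂ D
  refine ⟨⟨?_⟩, ?_⟩
  · simp only [Measure.add_apply, Measure.smul_apply, measure_univ, smul_eq_mul, mul_one, hst]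
  · simp only [ae_add_measure_iff]
    exact ⟨Measure.ae_smul_measure hae₁ s, Measure.ae_smul_measure hae₂ t⟩

/-- The non-tracing clause of the crux is closed under non-negative combinations. [folklore] -/
theorem nonTracing_mix
    (h₁ : ∀ D : DobrushinDomain, ∀ᵐ γ ∂(P₁ D), ∀ c : Curve ℂ, CurveClass.mk c = γ →
      ∀ s t : unitInterval, s < t → c '' Set.Icc s t ⊆ frontier D.carrier →
        (c '' Set.Icc s t).Subsingleton)
    (h₂ : ∀ D : DobrushinDomain, ∀ᵐ γ ∂(P₂ D), ∀ c : Curve ℂ, CurveClass.mk c = γ →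
      ∀ s t : unitInterval, s < t → c '' Set.Icc s t ⊆ frontier D.carrier →
        (c '' Set.Icc s t).Subsingleton) :
    ∀ D : DobrushinDomain, ∀ᵐ γ ∂(s • P₁ D + t • P₂ D), ∀ c : Curve ℂ, CurveClass.mk c = γ →
      ∀ s t : unitInterval, s < t → c '' Set.Icc s t ⊆ frontier D.carrier →
        (c '' Set.Icc s t).Subsingleton := by
  intro D
  simp only [ae_add_measure_iff]
  exact ⟨Measure.ae_smul_measure (h₁ D) s, Measure.ae_smul_measure (h₂ D) t⟩

/-- **Everything but Markov is convex**: a convex combination of two families each satisfying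
chordality, similarity covariance, both locality forms and non-tracing again satisfies all of
them. (The crux bundle minus `IsDomainMarkov`.) [folklore] -/
theorem admissibleExceptMarkov_mix (hst : s + t = 1)
    (c₁ : P₁.IsChordal) (c₂ : P₂.IsChordal)
    (v₁ : P₁.IsSimilarityCovariant) (v₂ : P₂.IsSimilarityCovariant)
    (l₁ : P₁.IsLocal) (l₂ : P₂.IsLocal)
    (i₁ : P₁.IsTargetIndependent) (i₂ : P₂.IsTargetIndependent)
    (n₁ : ∀ D : DobrushinDomain, ∀ᵐ γ ∂(P₁ D), ∀ c : Curve ℂ, CurveClass.mk c = γ →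
      ∀ s t : unitInterval, s < t → c '' Set.Icc s t ⊆ frontier D.carrier →
        (c '' Set.Icc s t).Subsingleton)
    (n₂ : ∀ D : DobrushinDomain, ∀ᵐ γ ∂(P₂ D), ∀ c : Curve ℂ, CurveClass.mk c = γ →
      ∀ s t : unitInterval, s < t → c '' Set.Icc s t ⊆ frontier D.carrier →
        (c '' Set.Icc s t).Subsingleton) :
    IsChordal (fun D => s • P₁ D + t • P₂ D) ∧
      IsSimilarityCovariant (fun D => s • P₁ D + t • P₂ D) ∧
      IsLocal (fun D => s • P₁ D + t • P₂ D) ∧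
      IsTargetIndependent (fun D => s • P₁ D + t • P₂ D) ∧
      ∀ D : DobrushinDomain, ∀ᵐ γ ∂(s • P₁ D + t • P₂ D), ∀ c : Curve ℂ, CurveClass.mk c = γ →
        ∀ s t : unitInterval, s < t → c '' Set.Icc s t ⊆ frontier D.carrier →
          (c '' Set.Icc s t).Subsingleton :=
  ⟨isChordal_mix s t c₁ c₂ hst, isSimilarityCovariant_mix s t v₁ v₂, isLocal_mix s t l₁ l₂,
    isTargetIndependent_mix s t i₁ i₂, nonTracing_mix s t n₁ n₂⟩

end Linear

/-! ### The domain Markov property is not convex -/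

section NonConvex

/-- The degenerate family "sit at the target": `δ_{const b}`. It is typed-Markov with the kernel
"whatever the past, sit at `b`" (the kernel depends on the configuration only through the target
point, so the `domain` clause is trivial). [folklore] -/
theorem isDomainMarkov_constTarget :
    IsDomainMarkov (fun D : DobrushinDomain =>
      Measure.dirac (CurveClass.mk (Curve.const (D.pt 1)))) := by
  classical
  refine ⟨fun D _ => Measure.dirac (CurveClass.mk (Curve.const (D.pt 1))), ?_, ?_, ?_⟩
  · intro D
    rfl
  · intro D F _ S T _ _
    rw [setLIntegral_dirac, Measure.dirac_apply, Measure.dirac_apply]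
    simp only [mem_preimage, CurveClass.stopAt_mk_const]
    by_cases hS : CurveClass.mk (Curve.const (D.pt 1)) ∈ S <;>
      by_cases hT : CurveClass.mk (Curve.const (D.pt 1)) ∈ T <;>
      simp [indicator, hS, hT]
  · intro D₁ D₂ p₁ p₂ _ _ h
    simp only [h]

/-- "Sit at the target" is local in restriction form (trivially: its law only reads `b`).
[folklore] -/
theorem isLocal_constTarget :
    IsLocal (fun D : DobrushinDomain => Measure.dirac (CurveClass.mk (Curve.const (D.pt 1)))) := by
  intro D D' _ _ h1 T _
  simp only [h1]

/-- "Sit at the target" is similarity covariant. [folklore] -/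
theorem isSimilarityCovariant_constTarget :
    IsSimilarityCovariant (fun D : DobrushinDomain =>
      Measure.dirac (CurveClass.mk (Curve.const (D.pt 1)))) := by
  intro D c hc w
  rw [Measure.map_dirac' (measurable_curveClassMap_similarity c hc w), CurveClass.map_mk]
  rfl

/-- The final segment "after never hitting the empty set" is the constant curve at the endpoint.
[folklore] -/
theorem startFrom_empty (c : CurveClass ℂ) :
    CurveClass.startFrom (∅ : Set ℂ) c = CurveClass.mk (Curve.const c.target) := by
  obtain ⟨γ, rfl⟩ := CurveClass.surjective_mk c
  rw [CurveClass.startFrom_mk_holds ∅ isClosed_empty,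
    Curve.startFrom_eq_const_of_hitParam_eq_one
      (Curve.hitParam_eq_one_of_forall_notMem fun t => Set.notMem_empty _),
    CurveClass.target_mk]

/-- Classes of constant curves are equal iff the points are. [folklore] -/
theorem mk_const_eq_mk_const_iff {x y : ℂ} :
    CurveClass.mk (Curve.const x) = CurveClass.mk (Curve.const y) ↔ x = y := by
  constructor
  · intro h
    have := congrArg CurveClass.source h
    simpa [CurveClass.source_mk, Curve.source_def] using this
  · rintro rfl
    rfl

/-- **The typed domain Markov property is not convex.** The half-half mixture of the two
typed-Markov families "sit at `a`" (`tipFamily`) and "sit at `b`" admits NO Markov extension: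
`initial` forces `Q D (const a) = ½ δ_{const a} + ½ δ_{const b}` (fresh restart), but disintegrating
at `F = ∅` (past = whole curve, future = constant at its endpoint) the event {past = const a,
future = const b} is null while the kernel charges it with mass `¼`. Label memory versus fresh
restart — the finite shadow of the renewal obstruction. [folklore] -/
theorem not_isDomainMarkov_mix_tip_constTarget :
    ¬ IsDomainMarkov (fun D : DobrushinDomain =>
        (2⁻¹ : ℝ≥0∞) • tipFamily D +
          (2⁻¹ : ℝ≥0∞) • Measure.dirac (CurveClass.mk (Curve.const (D.pt 1)))) := by
  classical
  rintro ⟨Q, hQ⟩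
  set D := DobrushinDomain.unitDisc with hD
  set A : CurveClass ℂ := CurveClass.mk (Curve.const (D.pt 0)) with hA
  set B : CurveClass ℂ := CurveClass.mk (Curve.const (D.pt 1)) with hB
  have hAB : A ≠ B := fun h =>
    absurd (D.pt_injective (mk_const_eq_mk_const_iff.1 h)) (by decide)
  have htip : tipFamily D = Measure.dirac A := rfl
  -- `initial`: the kernel at the trivial past is the fresh mixture
  have hinit : Q D A = (2⁻¹ : ℝ≥0∞) • Measure.dirac A + (2⁻¹ : ℝ≥0∞) • Measure.dirac B := by
    have := hQ.initial D
    simpa [htip] using this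
  -- `markov` at `F = ∅`, past event `{A}`, future event `{B}`
  have hmk := hQ.markov D ∅ isClosed_empty {A} {B} (measurableSet_singleton A)
    (measurableSet_singleton B)
  -- the joint event is empty: past `= A` forces future `= const a = A ≠ B`
  have hset : CurveClass.stopAt (∅ : Set ℂ) ⁻¹' ({A} : Set (CurveClass ℂ)) ∩
      CurveClass.startFrom (∅ : Set ℂ) ⁻¹' {B} = ∅ := by
    ext c
    simp only [mem_inter_iff, mem_preimage, mem_singleton_iff, stopAt_empty, mem_empty_iff_false,
      iff_false, not_and]
    rintro rfl
    rw [startFrom_empty, hA, CurveClass.target_mk]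
    exact hAB
  have hpre : CurveClass.stopAt (∅ : Set ℂ) ⁻¹' ({A} : Set (CurveClass ℂ)) = {A} := by
    ext c
    simp [stopAt_empty]
  rw [hset, measure_empty, hpre] at hmk
  simp only [stopAt_empty, htip] at hmk
  rw [Measure.restrict_add, Measure.restrict_smul, Measure.restrict_smul, lintegral_add_measure,
    lintegral_smul_measure, lintegral_smul_measure] at hmk
  rw [setLIntegral_dirac, setLIntegral_dirac, if_pos (mem_singleton A),
    if_neg (show CurveClass.mk (Curve.const (D.pt 1)) ∉ ({A} : Set (CurveClass ℂ)) from
      fun h => hAB (mem_singleton_iff.1 h).symm)] at hmk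
  -- `hmk : 0 = 2⁻¹ • Q D A {B} + 2⁻¹ • 0`
  rw [hinit] at hmk
  have hBB : (Measure.dirac B) ({B} : Set (CurveClass ℂ)) = 1 :=
    Measure.dirac_apply_of_mem (mem_singleton B)
  have hAB' : (Measure.dirac A) ({B} : Set (CurveClass ℂ)) = 0 := by
    rw [Measure.dirac_apply' _ (measurableSet_singleton B), indicator_of_notMem]
    exact hAB
  simp only [Measure.add_apply, Measure.smul_apply, smul_eq_mul, mul_zero, add_zero, hBB, hAB',
    mul_one, zero_add] at hmk
  -- `hmk : 0 = 2⁻¹ * 2⁻¹` in `ℝ≥0∞`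
  simp at hmk

end NonConvex

/-! ### No memory across Jordan renewals -/

section Renewal

variable {P : ChordalFamily} {Q : DobrushinDomain → CurveClass ℂ → Measure (CurveClass ℂ)}

/-- **Disintegration with the FRESH law at Jordan renewals.** If `P D`-almost every past stopped at
the closed set `F` has a remaining domain which is the carrier of a Dobrushin domain `E γ` marked at
the tip and the target, then the Markov disintegration at `F` reads
`P D {past ∈ S, future ∈ T} = ∫_{past ∈ S} P (E γ) T dP D` — the future is drawn from the family's
own fresh law (`kernel_eq_of_jordan_remaining`). [cite: Werner2007, §3.2] -/
theorem markov_eq_lintegral_fresh (hQ : P.IsMarkovExtension Q) (D : DobrushinDomain) {F : Set ℂ}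
    (hF : IsClosed F) (E : CurveClass ℂ → DobrushinDomain)
    (hE : ∀ᵐ γ ∂(P D), remainingDomain D (CurveClass.stopAt F γ) = (E γ).carrier ∧
      (CurveClass.stopAt F γ).target = (E γ).pt 0 ∧ D.pt 1 = (E γ).pt 1)
    {S T : Set (CurveClass ℂ)} (hS : MeasurableSet S) (hT : MeasurableSet T) :
    P D (CurveClass.stopAt F ⁻¹' S ∩ CurveClass.startFrom F ⁻¹' T) =
      ∫⁻ γ in CurveClass.stopAt F ⁻¹' S, P (E γ) T ∂(P D) := by
  rw [hQ.markov D F hF S T hS hT]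
  refine lintegral_congr_ae ?_
  filter_upwards [ae_restrict_of_ae hE] with γ hγ
  rw [kernel_eq_of_jordan_remaining hQ hγ.1 hγ.2.1 hγ.2.2]

/-- **No memory across Jordan renewals.** Under the hypothesis of `markov_eq_lintegral_fresh`, an
event `S` of pasts charged by `P D` and an event `T` of futures charged (uniformly, by `δ > 0`) by
EVERY fresh law `P (E γ)` must occur together with positive `P D`-probability. Hidden-label families
(a label read off the past that the future must repeat, e.g. the stretch axis of a rotation-averaged
stretched SLE₆, or the component of a mixture) violate this with `S = {label ∈ I₁}`,
`T = {label ∈ I₂}`, `I₁ ∩ I₂ = ∅`. [folklore] -/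
theorem no_memory_at_jordan_renewal (hQ : P.IsMarkovExtension Q) (D : DobrushinDomain) {F : Set ℂ}
    (hF : IsClosed F) (E : CurveClass ℂ → DobrushinDomain)
    (hE : ∀ᵐ γ ∂(P D), remainingDomain D (CurveClass.stopAt F γ) = (E γ).carrier ∧
      (CurveClass.stopAt F γ).target = (E γ).pt 0 ∧ D.pt 1 = (E γ).pt 1)
    {S T : Set (CurveClass ℂ)} (hS : MeasurableSet S) (hT : MeasurableSet T)
    (hnull : P D (CurveClass.stopAt F ⁻¹' S ∩ CurveClass.startFrom F ⁻¹' T) = 0)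
    {δ : ℝ≥0∞} (hδ : δ ≠ 0) (hfresh : ∀ γ, δ ≤ P (E γ) T)
    (hpos : P D (CurveClass.stopAt F ⁻¹' S) ≠ 0) : False := by
  have key := markov_eq_lintegral_fresh hQ D hF E hE hS hT
  rw [hnull] at key
  have hle : δ * P D (CurveClass.stopAt F ⁻¹' S) ≤
      ∫⁻ γ in CurveClass.stopAt F ⁻¹' S, P (E γ) T ∂(P D) := by
    rw [← setLIntegral_const]
    exact lintegral_mono fun γ => hfresh γ
  rw [← key, nonpos_iff_eq_zero, mul_eq_zero] at hle
  exact hle.elim hδ hpos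

end Renewal

end Summit.CriticalPhenomena.CardyFormulaZ2.Theorems.CardyRotToConfR2SymmetryUpgrade.Negative
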